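import Literature.Probability.Percolation.TriTileDomain
import Literature.Probability.Percolation.TriLatticeFill
import HarnessLib

/-!
# A concrete five-marked discrete domain: the lattice hexagon of radius 2

Topic `Literature/Probability/Percolation`; family `crit-perc`. Bollobás–Riordan (*Percolation*
(2006), Ch. 7 §7.2.2, pp. 168–169) define a `k`-marked discrete domain of the triangular lattice
`𝕋` (`TriMarkedDomain k` of `TriDiscreteDomain.lean`: a finite induced subgraph whose union of
hexagons is simply connected, neither it nor its outer boundary having a cut vertex, with marked
boundary sites "adjacent to at least two sites of `T ∖ G`", each marked at its second outside
neighbour). The structure's docstring checks the unit rhombus "by hand, not constructed here"; this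
file constructs a first concrete instance in the kernel:

* `hexBall2Five : TriMarkedDomain 5` — the 19-site hexagon `triBall 2` (= the single tile
  `tileUnion {0}` of `TriCoarseTiling.lean`), base dart `((2,-1),(3,-1))`, marks at positions
  `0, 5, 10, 15, 20` of its 30-dart boundary cycle, i.e. at the boundary sites
  `(2,-1), (1,1), (-1,2), (-2,1), (-1,-1)` (`hexBall2Five_markSite`).

All thirteen proof fields are discharged: the graph-theoretic ones (`connected`,
`outer_connected`, `no_cut`, `outer_no_cut`) and the disc fields (`euler`, `cycle`, `cycle_len`)
through `TriMarkedDomain.ofTileUnion {0}` (complement of the origin connected: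
`pathIn_compl_farSite` plus one outward step for the six unit vectors) and `IsTriDisc.rebase`,
transported along `tileUnion {0} = triBall 2`; the mark fields by `decide` on the boundary-cycle
machinery (`triBdryIter`). Intended use: a test object on which statements about marked domains
(crossing events, separating events, interface observables) can be instantiated and evaluated.

## References

* B. Bollobás, O. Riordan, *Percolation*, Cambridge University Press (2006), Ch. 7 §7.2.2,
  pp. 168–169.

## Mathlib / tree

Tree: `TriTileDomain.lean` (`TriMarkedDomain.ofTileUnion`, `tileUnion`), `TriLatticeFill.lean`
(`pathIn_compl_farSite`, `frameRad`, `farSite`), `TriDiscShelling.lean` (`IsTriDisc.rebase`),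
`TriDiscreteDomain.lean` (`TriMarkedDomain`, `triBdryIter`). Mathlib: `decide`.
-/

open Finset Literature.Probability.LatticeModels

noncomputable section

namespace Literature.Probability.Percolation

set_option maxRecDepth 400000

/-- The coarse singleton `{0}` is connected (trivially). [folklore] -/
private theorem pathIn_singleton_zero : ∀ c ∈ ({0} : Finset (Site 2)), ∀ c' ∈ ({0} : Finset (Site 2)),
    PathIn triGraph (↑({0} : Finset (Site 2)) : Set (Site 2)) c c' := by
  intro c hc c' hc'
  rw [mem_singleton] at hc hc'
  subst hc; subst hc'
  exact PathIn.refl (by simp)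

/-- The six neighbours of the origin step outward to a far site avoiding the origin (a finite
check). [folklore] -/
private theorem unit_step_far : ∀ o ∈ (triBall 1).erase (0 : Site 2),
    triGraph.Adj o (o + o) ∧ o + o ∉ ({0} : Finset (Site 2)) ∧
      ((1 : ℤ) < |(o + o) 0| ∨ (1 : ℤ) < |(o + o) 1| ∨ (1 : ℤ) < |(o + o) 0 + (o + o) 1|) := by
  decide

/-- `frameRad {0} = 1`. [folklore] -/
private theorem frameRad_singleton_zero : frameRad ({0} : Finset (Site 2)) = 1 := by
  decide

/-- The complement of the origin in `𝕋` is connected: every site `≠ 0` is joined to the far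
site of `{0}` avoiding `0` (far sites by `pathIn_compl_farSite`, the six unit vectors after one
outward step). [folklore] -/
private theorem pathIn_compl_singleton_zero : ∀ o ∉ ({0} : Finset (Site 2)), ∀ o' ∉ ({0} : Finset (Site 2)),
    PathIn triGraph ((↑({0} : Finset (Site 2)) : Set (Site 2))ᶜ) o o' := by
  have key : ∀ o ∉ ({0} : Finset (Site 2)),
      PathIn triGraph ((↑({0} : Finset (Site 2)) : Set (Site 2))ᶜ) o (farSite {0}) := by
    intro o ho
    by_cases hfar : (frameRad ({0} : Finset (Site 2)) : ℤ) < |o 0| ∨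
        (frameRad ({0} : Finset (Site 2)) : ℤ) < |o 1| ∨ (frameRad ({0} : Finset (Site 2)) : ℤ) < |o 0 + o 1|
    · exact pathIn_compl_farSite hfar
    · have ho1 : o ∈ (triBall 1).erase (0 : Site 2) := by
        rw [mem_erase, mem_triBall_iff]
        refine ⟨fun h => ho (mem_singleton.2 h), ?_⟩
        rw [frameRad_singleton_zero] at hfar
        simp only [not_or, not_lt, Nat.cast_one] at hfar
        unfold triNorm
        exact max_le hfar.1 (max_le hfar.2.1 hfar.2.2)
      obtain ⟨hadj, h2, hfar2⟩ := unit_step_far o ho1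
      have hmem : o ∈ ((↑({0} : Finset (Site 2)) : Set (Site 2))ᶜ) := by
        rw [Set.mem_compl_iff, mem_coe]; exact ho
      have hmem2 : o + o ∈ ((↑({0} : Finset (Site 2)) : Set (Site 2))ᶜ) := by
        rw [Set.mem_compl_iff, mem_coe]; exact h2
      have hfar2' : (frameRad ({0} : Finset (Site 2)) : ℤ) < |(o + o) 0| ∨
          (frameRad ({0} : Finset (Site 2)) : ℤ) < |(o + o) 1| ∨
            (frameRad ({0} : Finset (Site 2)) : ℤ) < |(o + o) 0 + (o + o) 1| := by
        rw [frameRad_singleton_zero]; exact_mod_cast hfar2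
      exact (PathIn.of_adj hmem hmem2 hadj).trans (pathIn_compl_farSite hfar2')
  intro o ho o' ho'
  exact (key o ho).trans (key o' ho').symm

/-- The unmarked discrete domain on the single tile `tileUnion {0}` (Bollobás–Riordan 2006,
Ch. 7 §7.2.2 p. 168, via `TriMarkedDomain.ofTileUnion`). [folklore] -/
private def hexBall2Domain₀ : TriMarkedDomain 0 :=
  TriMarkedDomain.ofTileUnion {0} ⟨0, mem_singleton_self 0⟩ pathIn_singleton_zero pathIn_compl_singleton_zero

/-- The single tile at the origin is the lattice hexagon of radius `2`. [folklore] -/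
private theorem tileUnion_singleton_zero : tileUnion ({0} : Finset (Site 2)) = triBall 2 := by
  decide

/-- The base dart of the five-marked hexagon: from the boundary site `(2,-1)` to its second
outside neighbour `(3,-1)` (Bollobás–Riordan 2006, Ch. 7 §7.2.2 p. 169: marks point to the second
outside neighbour). [folklore] -/
def hexBall2Base : Site 2 × Site 2 := (![2, -1], ![3, -1])

/-- The positions of the five marked darts along the 30-dart boundary cycle. [folklore] -/
def hexBall2Pos : Fin 5 → ℕ := ![0, 5, 10, 15, 20]

/-- The hexagon of radius `2` is a disc based at `hexBall2Base`. [folklore] -/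
private theorem hexBall2_isTriDisc : IsTriDisc (triBall 2) hexBall2Base := by
  have h := hexBall2Domain₀.isTriDisc
  rw [hexBall2Domain₀, TriMarkedDomain.ofTileUnion_verts, tileUnion_singleton_zero] at h
  exact h.rebase (by decide)

/-- **The five-marked lattice hexagon of radius 2** as a discrete domain of Bollobás–Riordan
(2006, Ch. 7 §7.2.2 pp. 168–169): sites `triBall 2` (19 sites), base dart `((2,-1),(3,-1))`,
marks at positions `0, 5, 10, 15, 20` of the 30-dart boundary cycle, i.e. at the sites
`(2,-1), (1,1), (-1,2), (-2,1), (-1,-1)`, each adjacent to exactly two sites of `T ∖ G` and marked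
at the second. [cite: BollobasRiordan2006, Ch. 7 §7.2.2 pp. 168–169] -/
def hexBall2Five : TriMarkedDomain 5 where
  verts := triBall 2
  base := hexBall2Base
  pos := hexBall2Pos
  base_mem := by decide
  connected := by
    have h := hexBall2Domain₀.connected
    rw [hexBall2Domain₀, TriMarkedDomain.ofTileUnion_verts, tileUnion_singleton_zero] at h
    exact h
  outer_connected := by
    have h := hexBall2Domain₀.outer_connected
    rw [hexBall2Domain₀, TriMarkedDomain.ofTileUnion_verts, tileUnion_singleton_zero] at h
    exact h
  no_cut := by
    have h := hexBall2Domain₀.no_cut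
    rw [hexBall2Domain₀, TriMarkedDomain.ofTileUnion_verts, tileUnion_singleton_zero] at h
    exact h
  outer_no_cut := by
    have h := hexBall2Domain₀.outer_no_cut
    rw [hexBall2Domain₀, TriMarkedDomain.ofTileUnion_verts, tileUnion_singleton_zero] at h
    exact h
  euler := hexBall2_isTriDisc.euler
  cycle := hexBall2_isTriDisc.cycle
  cycle_len := hexBall2_isTriDisc.cycle_len
  pos_zero := fun _ => rfl
  pos_strictMono := by
    intro a b hab
    revert a b
    decide
  pos_lt := by decide
  mark_pred := by decide
  mark_pred_pred := by decide
  mark_injective := by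
    intro a b hab
    revert a b
    decide

/-- The site set of `hexBall2Five` is `triBall 2`. [cite: BollobasRiordan2006, Ch. 7 §7.2.2 p. 168] -/
@[simp] theorem hexBall2Five_verts : hexBall2Five.verts = triBall 2 := rfl

/-- The marked sites of `hexBall2Five` are `(2,-1), (1,1), (-1,2), (-2,1), (-1,-1)` (in the order
of the marks, anticlockwise). [cite: BollobasRiordan2006, Ch. 7 §7.2.2 p. 169] -/
theorem hexBall2Five_markSite :
    (hexBall2Five.markSite 0, hexBall2Five.markSite 1, hexBall2Five.markSite 2, hexBall2Five.markSite 3,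
      hexBall2Five.markSite 4) = (![2, -1], ![1, 1], ![-1, 2], ![-2, 1], ![-1, -1]) := by
  decide

/-- The boundary cycle of `hexBall2Five` has `30` darts. [cite: BollobasRiordan2006, Ch. 7 §7.2.2 p. 168] -/
theorem hexBall2Five_bdryLen : hexBall2Five.bdryLen = 30 := by
  decide

/-! ### The smallest five-marked domain: the lattice hexagon of radius 1 (7 sites; appended 2026-08-22)

With `2^7 = 128` site configurations this is the test domain for kernel evaluation (`decide`) of statements about
five-marked domains. Construction: `TriMarkedDomain.ofOneBlock` (connectivity through the hub `0`; complement
connected via `pathIn_compl_farSite` and a two-step outward escape for the ring `triBall 3 ∖ triBall 1`, a finite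
`decide`; one-block ring patterns by `decide`), then `IsTriDisc.rebase` and the mark fields by `decide`. -/

/-- Every site of `triBall 1` is the origin or adjacent to it (finite check). [folklore] -/
private theorem hexBall1_hub : ∀ p ∈ triBall 1, p = 0 ∨ triGraph.Adj p 0 := by
  decide

/-- `triBall 1` is connected (through the hub `0`). [folklore] -/
private theorem hexBall1_pathIn : ∀ p ∈ triBall 1, ∀ q ∈ triBall 1,
    PathIn triGraph (↑(triBall 1) : Set (Site 2)) p q := by
  have h0 : (0 : Site 2) ∈ (↑(triBall 1) : Set (Site 2)) := by
    rw [mem_coe]; decide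
  have key : ∀ p ∈ triBall 1, PathIn triGraph (↑(triBall 1) : Set (Site 2)) p 0 := by
    intro p hp
    rcases hexBall1_hub p hp with rfl | hadj
    · exact PathIn.refl h0
    · exact PathIn.of_adj (mem_coe.2 hp) h0 hadj
  intro p hp q hq
  exact (key p hp).trans (key q hq).symm

/-- `frameRad (triBall 1) = 3`. [folklore] -/
private theorem frameRad_hexBall1 : frameRad (triBall 1) = 3 := by
  decide

/-- The six unit directions as an explicit finite set. [folklore] -/
private def sixDirs : Finset (Site 2) :=
  {![1, 0], ![-1, 0], ![0, 1], ![0, -1], ![1, -1], ![-1, 1]}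

/-- Two outward steps from any site of the ring `triBall 3 ∖ triBall 1` avoid `triBall 1` and
leave `triBall 3` (finite check). [folklore] -/
private theorem hexBall1_escape : ∀ o ∈ triBall 3 \ triBall 1, ∃ d ∈ sixDirs,
    triGraph.Adj o (o + d) ∧ o + d ∉ triBall 1 ∧ triGraph.Adj (o + d) (o + d + d) ∧
      o + d + d ∉ triBall 1 ∧ o + d + d ∉ triBall 3 := by
  decide

/-- The complement of `triBall 1` in `𝕋` is connected: every outside site is joined to the far
site avoiding `triBall 1`. [folklore] -/
private theorem hexBall1_pathIn_compl : ∀ o ∉ triBall 1, ∀ o' ∉ triBall 1,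
    PathIn triGraph ((↑(triBall 1) : Set (Site 2))ᶜ) o o' := by
  have far : ∀ x : Site 2, x ∉ triBall 3 → PathIn triGraph ((↑(triBall 1) : Set (Site 2))ᶜ) x (farSite (triBall 1)) := by
    intro x hx
    have hx' : x ∉ triBall (frameRad (triBall 1)) := by rw [frameRad_hexBall1]; exact hx
    exact pathIn_compl_farSite (far_of_not_mem_triBall hx')
  have key : ∀ o ∉ triBall 1, PathIn triGraph ((↑(triBall 1) : Set (Site 2))ᶜ) o (farSite (triBall 1)) := by
    intro o ho
    by_cases h3 : o ∈ triBall 3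
    · obtain ⟨d, -, h1, h2, h3', h4, h5⟩ := hexBall1_escape o (mem_sdiff.2 ⟨h3, ho⟩)
      have m0 : o ∈ ((↑(triBall 1) : Set (Site 2))ᶜ) := by rw [Set.mem_compl_iff, mem_coe]; exact ho
      have m1 : o + d ∈ ((↑(triBall 1) : Set (Site 2))ᶜ) := by rw [Set.mem_compl_iff, mem_coe]; exact h2
      have m2 : o + d + d ∈ ((↑(triBall 1) : Set (Site 2))ᶜ) := by rw [Set.mem_compl_iff, mem_coe]; exact h4
      exact ((PathIn.of_adj m0 m1 h1).trans (PathIn.of_adj m1 m2 h3')).trans (far _ h5)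
    · exact far o h3
  intro o ho o' ho'
  exact (key o ho).trans (key o' ho').symm

/-- One-block ring patterns at every site of `triBall 1` and of its outer boundary (all lie in
`triBall 2`; finite check). [folklore] -/
private theorem hexBall1_oneBlock : ∀ x, x ∈ triBall 1 ∨ x ∈ triOuterBdry (triBall 1) → OneBlockAt (triBall 1) x := by
  have hsub1 : triBall 1 ⊆ triBall 2 := by decide
  have hsub2 : triOuterBdry (triBall 1) ⊆ triBall 2 := by decide
  have hblk : ∀ x ∈ triBall 2, OneBlockAt (triBall 1) x := by
    unfold OneBlockAt; decide
  intro x hx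
  rcases hx with hx | hx
  · exact hblk x (hsub1 hx)
  · exact hblk x (hsub2 hx)

/-- The unmarked discrete domain on `triBall 1`. [folklore] -/
private def hexBall1Domain₀ : TriMarkedDomain 0 :=
  TriMarkedDomain.ofOneBlock (triBall 1) ⟨0, by decide⟩ hexBall1_pathIn hexBall1_pathIn_compl hexBall1_oneBlock

/-- The base dart of the five-marked unit hexagon: from `(1,0)` to its second outside neighbour
`(2,0)`. [folklore] -/
def hexBall1Base : Site 2 × Site 2 := (![1, 0], ![2, 0])

/-- The positions of the five marked darts along the 18-dart boundary cycle. [folklore] -/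
def hexBall1Pos : Fin 5 → ℕ := ![0, 3, 6, 9, 12]

/-- `triBall 1` is a disc based at `hexBall1Base`. [folklore] -/
private theorem hexBall1_isTriDisc : IsTriDisc (triBall 1) hexBall1Base :=
  hexBall1Domain₀.isTriDisc.rebase (by decide)

/-- **The five-marked lattice hexagon of radius 1** (Bollobás–Riordan 2006, Ch. 7 §7.2.2
pp. 168–169): sites `triBall 1` (7 sites), base dart `((1,0),(2,0))`, marks at positions
`0, 3, 6, 9, 12` of the 18-dart boundary cycle, i.e. at the sites `(1,0), (0,1), (-1,1), (-1,0),
(0,-1)`, each adjacent to three sites of `T ∖ G` and marked at the second. The smallest domain on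
which five marks fit; `2^7` configurations. [cite: BollobasRiordan2006, Ch. 7 §7.2.2 pp. 168–169] -/
def hexBall1Five : TriMarkedDomain 5 where
  verts := triBall 1
  base := hexBall1Base
  pos := hexBall1Pos
  base_mem := by decide
  connected := hexBall1Domain₀.connected
  outer_connected := hexBall1Domain₀.outer_connected
  no_cut := hexBall1Domain₀.no_cut
  outer_no_cut := hexBall1Domain₀.outer_no_cut
  euler := hexBall1_isTriDisc.euler
  cycle := hexBall1_isTriDisc.cycle
  cycle_len := hexBall1_isTriDisc.cycle_len
  pos_zero := fun _ => rfl
  pos_strictMono := by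
    intro a b hab
    revert a b
    decide
  pos_lt := by decide
  mark_pred := by decide
  mark_pred_pred := by decide
  mark_injective := by
    intro a b hab
    revert a b
    decide

/-- The site set of `hexBall1Five` is `triBall 1`. [cite: BollobasRiordan2006, Ch. 7 §7.2.2 p. 168] -/
@[simp] theorem hexBall1Five_verts : hexBall1Five.verts = triBall 1 := rfl

/-- The marked sites of `hexBall1Five` are `(1,0), (0,1), (-1,1), (-1,0), (0,-1)`. [cite: BollobasRiordan2006, Ch. 7 §7.2.2 p. 169] -/
theorem hexBall1Five_markSite :
    (hexBall1Five.markSite 0, hexBall1Five.markSite 1, hexBall1Five.markSite 2, hexBall1Five.markSite 3,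
      hexBall1Five.markSite 4) = (![1, 0], ![0, 1], ![-1, 1], ![-1, 0], ![0, -1]) := by
  decide

/-- The boundary cycle of `hexBall1Five` has `18` darts. [cite: BollobasRiordan2006, Ch. 7 §7.2.2 p. 168] -/
theorem hexBall1Five_bdryLen : hexBall1Five.bdryLen = 18 := by
  decide

end Literature.Probability.Percolation

end
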